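import Literature.AlgebraicGeometry.HodgeTheory.HyperplaneSectionMonodromy
import Literature.AlgebraicGeometry.HodgeTheory.HyperplaneSectionRationalMonodromy
import Literature.AlgebraicGeometry.HodgeTheory.LocallyTrivialExtensionClasses

/-!
Scratch (line lead, cycle 2; REVISED by the continuation lead c5 in cycle 6; note by lead c6 in cycle 7): CANDIDATE typed forms
of the crux LocalTubeSpan (c-free), for the planner.

CYCLE-6 REVISION (lead c5).  Of the two cycle-2 candidates only the COLIMIT form
`LocalTubeSpanCFree` is sound.  The "surrogate at all small open sets" form `LocalTubeSpanCFreeBalls`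
quantifies over ARBITRARY small open neighbourhoods `N'` of `t₀`; for `N'` = (tiny ball around `t₀`)
∪ (thin open tubes around loops `g₂, g₃` based in the punctured tiny ball) the local subgroup is
`⟨G_ball, g₂, g₃⟩`, which is not a local fundamental group of the singularity and can be a THIN
transvection group (at a nodal `t₀` with cycle `δ₁`, take `g₂ = T_{δ₂'}`, `g₃ = T_{δ₁+δ₂'}` with
`⟨δ₁, δ₂'⟩ = 4`, available in a complete lattice by Janssen's Thm 2.9; the third map of that group
is not injective by `…ThinMu`), so `LocalTubeSpanCFreeBalls` is very likely FALSE even at nodal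
points and is WITHDRAWN as a candidate (kept below, renamed `…Withdrawn`, only as a record).  The
companion vacuity theorem `localTubeSpan_not_forall_open_nhds_isPathConnected` (file
`Theorems/…TypedBasis`, p125024) shows that the path-connected variant of the same quantifier
("all small open `N'` have path-connected `ι⁻¹ N'`") is outright unsatisfiable.

CYCLE-7 NOTE (lead c6).  The ARITHMETIC input of every conditional instance is now ONE named fact,
`Janssen1983_thm2_5` (= [Schnell2010] Thm. 10): `localTubeSpan_janssen_thm2_9_of_thm2_5 :
Janssen1983_thm2_5 → Janssen1983_thm2_9` and `localTubeSpan_schnell2010_lemma11_of_thm2_5 :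
Janssen1983_thm2_5 → Schnell2010_lemma11` (file `Theorems/…OneFact`, p129433); e.g. the one-complete-orbit
member along a basis is `localTubeSpan_cfree_at_of_completeOrbitBasis_of_thm2_5 h25 …`.  (The withdrawn
example above used Thm 2.9 only to exhibit `δ₁ + δ₂'`-type vanishing cycles; it is a corollary of 2.5 too.)

HOW `LocalTubeSpanCFree` IS PROVED (the line's glue, file `Theorems/…TypedBasis`):
`localTubeSpan_mem_localKernel_vanishing_of_rat_hasBasis_one` — Lefschetz splitting (discharged from
hard Lefschetz, `…LefschetzSplitting`/`…HardLefschetzMember`) + a neighbourhood BASIS of `t₀` whose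
basic sets have path-connected punctured preimage (Milnor balls) + `ℚ`-cyclic detection of the
rational monodromy (`DirectImageLocalSystem.ratMonodromy`) at ONE local subgroup per basic set
(the covered transvection configurations: `…TypedInstances`, `…NCNodal`, `…DistinguishedBasis`,
`…Radical` …).  Under stabilisation of the local subgroups along the basis (conic structure) the
statement at `t₀` is EQUIVALENT to the algebraic surrogate at the stable local group
(`localTubeSpan_stableLocalGroup`, p125399), and granting it along `Δ` the locally trivial classes
are exactly the locally undetected ones (`localTubeSpan_locTrivCharacterisation`, p125352).
-/

set_option linter.dupNamespace false

noncomputable section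

open CategoryTheory AlgebraicGeometry
open _root_.Topology Filter
open Literature.AlgebraicGeometry Literature.AlgebraicGeometry.HodgeTheory
  Literature.AlgebraicGeometry.Motives

namespace Summit.HodgeConjecture.HodgeConjecture.Cruxes.LocalTubeSpan.Typed

/-- The inclusion `U = (ℙᴺ)^*(ℂ) ∖ 𝒟_X(ℂ) ↪ (ℙᴺ)^*(ℂ)` as a continuous map. -/
def incl (N : ℕ) {X : SchemeOver ℂ} (ι : X ⟶ projectiveSpace N ℂ) (n : ℕ) :
    C(universalSmoothLocus N ι n, ComplexPoints (dualProjectiveSpace N ℂ)) :=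
  ⟨Subtype.val, continuous_subtype_val⟩

/-- CANDIDATE typed crux (THE candidate after cycle 6; c-free local Schnell theorem, colimit form):
for a smooth projective `X ⊂ ℙᴺ` of dimension `n + 1` (`n = 2p - 1`), a monodromy package `D` of
its universal hyperplane section, a base point `s ∈ U` and a point `t₀` of the discriminant: a
class `ξ ∈ H¹(π₁(U, s), V_s)` (`V` the vanishing local system) that is UNDETECTED by every element
of the local subgroups of some neighbourhood of `t₀` (all view points, all paths) is LOCALLY TRIVIAL
at `t₀` (lies in the tree's `localKernel`).  The converse holds by `H1resKer_le_ker_evalCoinvOn`.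
Faithful to the printed crux for `p ≥ 2`, `d ≫ 0` (Schnell Prop. 7: `c` is an isomorphism); stated
here for every closed immersion `ι` (no `d ≥ d₀`: the tree has no Veronese re-embedding; the c-free
form holds trivially at cyclic local groups, e.g. separating nodes, so no small-`d` counterexample
is known to the leads).  Proved from basis-wise `ℚ`-cyclic detection by
`localTubeSpan_mem_localKernel_vanishing_of_rat_hasBasis_one` (Theorems/…TypedBasis). -/
def LocalTubeSpanCFree : Prop :=
  ∀ (N n : ℕ) ⦃X : SchemeOver ℂ⦄ (hX : IsSmoothProjective (n + 1) X)
    (ι : X ⟶ projectiveSpace N ℂ) [IsClosedImmersion ι.left]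
    (D : UniversalHyperplaneSectionLocalSystem N ι n) (μ : OrientationFamily) ⦃b : ℕ⦄
    (hb : n + 2 * (n + 1) = b + 2 * n) (s : universalSmoothLocus N ι n)
    (t₀ : ComplexPoints (dualProjectiveSpace N ℂ)), t₀ ∈ universalDiscriminant N ι n →
    ∀ ξ : groupCohomology.H1 (monodromyRepObj (D.vanishingLocalSystem μ hX hb) s),
      (∃ N' ∈ 𝓝 t₀, ∀ (s' : universalSmoothLocus N ι n) (hs' : incl N ι n s' ∈ N') (γ : Path s' s),
        evalCoinvOn (monodromyRepObj (D.vanishingLocalSystem μ hX hb) s)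
          (localSubgroup (incl N ι n) s N' hs' γ) ξ = 0) →
      ξ ∈ localKernel (incl N ι n) (D.vanishingLocalSystem μ hX hb) s t₀

/-- WITHDRAWN candidate (cycle 2's "surrogate at all small open sets" form; see the module
docstring: over-strong — arbitrary small open `N'` have junk local subgroups, possibly thin — and
very likely false even at nodal points).  Kept only as a record; do NOT type the crux with it. -/
def LocalTubeSpanCFreeBallsWithdrawn : Prop :=
  ∀ (N n : ℕ) ⦃X : SchemeOver ℂ⦄ (hX : IsSmoothProjective (n + 1) X)
    (ι : X ⟶ projectiveSpace N ℂ) [IsClosedImmersion ι.left]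
    (D : UniversalHyperplaneSectionLocalSystem N ι n) (μ : OrientationFamily) ⦃b : ℕ⦄
    (hb : n + 2 * (n + 1) = b + 2 * n) (s : universalSmoothLocus N ι n)
    (t₀ : ComplexPoints (dualProjectiveSpace N ℂ)), t₀ ∈ universalDiscriminant N ι n →
    ∃ N₀ ∈ 𝓝 t₀, ∀ N' ∈ 𝓝 t₀, N' ⊆ N₀ → IsOpen N' →
      ∀ (s' : universalSmoothLocus N ι n) (hs' : incl N ι n s' ∈ N') (γ : Path s' s),
        LinearMap.ker (evalCoinvOn (monodromyRepObj (D.vanishingLocalSystem μ hX hb) s)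
            (localSubgroup (incl N ι n) s N' hs' γ)) =
          H1resKer (monodromyRepObj (D.vanishingLocalSystem μ hX hb) s)
            (localSubgroup (incl N ι n) s N' hs' γ)

/-- The BASIS-WISE hypothesis shape under which the line proves `LocalTubeSpanCFree` at a point
`t₀` (for the planner: this is what the geometric presentation must supply, per configuration type)
— some neighbourhood basis `(b i)_{p i}` of `t₀` whose basic sets have path-connected punctured
preimage and ONE view point at which Schnell's third map of the rational monodromy restricted to the
local subgroup is injective.  (A Prop-valued function of the data, not a crux candidate.) -/
def BasiswiseDetectionAt (N n : ℕ) {X : SchemeOver ℂ} (ι : X ⟶ projectiveSpace N ℂ)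
    [IsClosedImmersion ι.left] (D : UniversalHyperplaneSectionLocalSystem N ι n)
    (s : universalSmoothLocus N ι n) (t₀ : ComplexPoints (dualProjectiveSpace N ℂ)) : Prop :=
  ∃ (κ : Type) (p : κ → Prop) (b : κ → Set (ComplexPoints (dualProjectiveSpace N ℂ))),
    (𝓝 t₀).HasBasis p b ∧
      ∀ i, p i → IsPathConnected (incl N ι n ⁻¹' b i) ∧
        ∃ (s' : universalSmoothLocus N ι n) (hs' : incl N ι n s' ∈ b i) (γ : Path s' s),
          Function.Injective (evalCoinv (Rep.res (localSubgroup (incl N ι n) s (b i) hs' γ).subtype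
            (Rep.of (D.toDirectImageLocalSystem.ratMonodromy n s))))

end Summit.HodgeConjecture.HodgeConjecture.Cruxes.LocalTubeSpan.Typed

end
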